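import Summits.CriticalPhenomena.SAWScalingLimit.Theorems.SAWLoopFugacityFlowAvoidanceLimitInteriorRatioLimitSubharmonic

/-!
# Exit (Dirichlet) representation of harmonic functions of the edge-killed walk
— UBHP step-zero brick B-exit of line `symplectic-fermion-anchor`
(crux `SAWLoopFugacityFlow.AvoidanceLimit`, stmt-CriticalPhenomena-10649)

The uniform boundary Harnack principle `stub_uniformBHP` of the line concerns functions
`h : Λ → ℝ` on a volume `Λ ⊆ ℤ²` that are harmonic for the EDGE-killed simple random walk of a
subgraph `H ≤ ℤ²`: `(P h)(x) = h(x)` with `P = ¼·adjMat H Λ`. This file proves the exit (Poisson /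
Dirichlet) representation of such an `h` on a sub-region `T ⊆ Λ` through the Green's function
`G_T = greenEntry H T = (1 − ¼·adjMat H T)⁻¹` of the walk killed on leaving `T`:

* `transitionHarmonic_eq_sum_greenEntry_mul` (registered signature) — if `(P h)(x) = h(x)` at every
  `x ∈ Λ` lying in `T`, then for `u ∈ T`,
  `h(u) = Σ_{w ∈ T} G_T(u, w) · ¼ Σ_{x ∈ Λ ∖ T, x ∼_H w} h(x)`.

This is the identity `H(u) = Σ_x Z_Θ(u, x) H(x)` opening the proof of the boundary Harnack
contraction (Chelkak–Wan 2021, Lemma 3.7), written for the tree's edge-killed walk; here it is pure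
finite-dimensional linear algebra: harmonicity at `w ∈ T` splits as `g = P_T g + b` for the
restriction `g = h|_T` and the boundary term `b`, i.e. `(1 − P_T) g = b`, and `1 − P_T` is
invertible on every finite piece of `ℤ²` (`KilledGreen.isUnit_one_sub_transition`).

Sources: G. F. Lawler, *Intersections of Random Walks* (1991), §1.4–1.5 [Lawler1991]; D. Chelkak,
Y. Wan, Electron. J. Probab. 26 (2021), §3.2 [ChelkakWan2021]; folklore linear algebra.
No definitions.
-/

noncomputable section

open scoped BigOperators Classical
open Finset Matrix
open Literature.Probability.RandomPlanarGeometry Literature.Probability.LatticeModels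

namespace Summit.CriticalPhenomena.SAWScalingLimit.Theorems.AvoidanceLimit.Anchor

open KilledGreen

/-! ## Sums over the subtype `↥Λ` as sums over `Site 2` -/

/-- A filtered sum over the subtype `↥Λ` is the filtered sum over `Λ` of the zero extension.
[folklore] -/
theorem sum_filter_univ_eq_sum_filter_dite (Λ : Finset (Site 2)) (p : Site 2 → Prop)
    [DecidablePred p] (f : ↥Λ → ℝ) :
    ∑ y ∈ univ.filter (fun y : ↥Λ => p y), f y =
      ∑ z ∈ Λ.filter p, (if hz : z ∈ Λ then f ⟨z, hz⟩ else 0) := by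
  rw [Finset.sum_filter, Finset.sum_filter, ← Finset.sum_attach Λ]
  refine Finset.sum_congr rfl fun y _ => ?_
  rw [dif_pos y.2]

/-- `(P f)(x) = ¼ Σ_{z ∈ Λ, z ∼_H x} f̃(z)` with `f̃` the zero extension of `f : Λ → ℝ` off `Λ`.
[folklore] -/
theorem transition_mulVec_eq_sum_filter_dite (H : SimpleGraph (Site 2)) (Λ : Finset (Site 2))
    (f : ↥Λ → ℝ) (x : ↥Λ) :
    (((4 : ℝ)⁻¹ • adjMat H Λ) *ᵥ f) x =
      4⁻¹ * ∑ z ∈ Λ.filter (fun z => H.Adj x z), (if hz : z ∈ Λ then f ⟨z, hz⟩ else 0) := by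
  rw [transition_mulVec_apply, sum_filter_univ_eq_sum_filter_dite Λ (fun z => H.Adj x z) f]

/-- Splitting a filtered sum over `Λ` into the part inside `T ⊆ Λ` and the part outside `T`.
[folklore] -/
theorem sum_filter_eq_sum_filter_add_sum_filter_not_mem {Λ T : Finset (Site 2)} (hTΛ : T ⊆ Λ)
    (p : Site 2 → Prop) [DecidablePred p] (F : Site 2 → ℝ) :
    ∑ z ∈ Λ.filter p, F z =
      ∑ z ∈ T.filter p, F z + ∑ z ∈ Λ.filter (fun z => z ∉ T ∧ p z), F z := by
  rw [← Finset.sum_filter_add_sum_filter_not (Λ.filter p) (· ∈ T) F, Finset.filter_filter,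
    Finset.filter_filter]
  congr 1
  · refine Finset.sum_congr ?_ fun _ _ => rfl
    ext z
    simp only [Finset.mem_filter]
    exact ⟨fun h => ⟨h.2.2, h.2.1⟩, fun h => ⟨hTΛ h.1, h.2, h.1⟩⟩
  · refine Finset.sum_congr ?_ fun _ _ => rfl
    ext z
    simp only [Finset.mem_filter]
    exact ⟨fun h => ⟨h.1, h.2.2, h.2.1⟩, fun h => ⟨h.1, h.2.2, h.2.1⟩⟩

/-! ## The linear system `(1 − P_T) h|_T = b` and its inversion -/

/-- **Harmonicity on `T` as a linear system for the restriction.** If `h : Λ → ℝ` is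
`P_{H|Λ}`-harmonic at every vertex of `Λ` lying in `T ⊆ Λ`, then its restriction `g = h|_T`
satisfies `(1 − ¼·adjMat H T) g = b`, where `b(w) = ¼ Σ_{x ∈ Λ ∖ T, x ∼_H w} h(x)` is the
boundary term: the `H|_Λ`-neighbours of `w ∈ T` split into those in `T` (the `H|_T`-neighbours)
and those outside. [folklore] -/
theorem one_sub_transition_mulVec_restrict_eq (H : SimpleGraph (Site 2)) {Λ T : Finset (Site 2)}
    (hTΛ : T ⊆ Λ) (h : ↥Λ → ℝ)
    (hharm : ∀ x : ↥Λ, (x : Site 2) ∈ T → Matrix.mulVec ((4 : ℝ)⁻¹ • adjMat H Λ) h x = h x) :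
    ((1 : Matrix T T ℝ) - (4 : ℝ)⁻¹ • adjMat H T) *ᵥ (fun w : ↥T => h ⟨w, hTΛ w.2⟩) =
      fun w : ↥T => (4 : ℝ)⁻¹ * ∑ x ∈ (Finset.univ : Finset ↥Λ).filter
        (fun x : ↥Λ => (x : Site 2) ∉ T ∧ H.Adj w (x : Site 2)), h x := by
  funext w
  simp only [Matrix.sub_mulVec, Pi.sub_apply, Matrix.one_mulVec]
  -- harmonicity at `w`, as a sum over `Λ.filter (H.Adj w ·)` of the zero extension
  have h1 : h ⟨w, hTΛ w.2⟩ =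
      4⁻¹ * ∑ z ∈ Λ.filter (fun z => H.Adj w z), (if hz : z ∈ Λ then h ⟨z, hz⟩ else 0) := by
    rw [← hharm ⟨w, hTΛ w.2⟩ w.2, transition_mulVec_eq_sum_filter_dite]
  -- the `P_T`-average, as a sum over `T.filter (H.Adj w ·)` of the same zero extension
  have h2 : (((4 : ℝ)⁻¹ • adjMat H T) *ᵥ fun w : ↥T => h ⟨w, hTΛ w.2⟩) w =
      4⁻¹ * ∑ z ∈ T.filter (fun z => H.Adj w z), (if hz : z ∈ Λ then h ⟨z, hz⟩ else 0) := by
    rw [transition_mulVec_eq_sum_filter_dite]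
    congr 1
    refine Finset.sum_congr rfl fun z hz => ?_
    have hzT : z ∈ T := (Finset.mem_filter.1 hz).1
    rw [dif_pos hzT, dif_pos (hTΛ hzT)]
  -- the boundary term, as a sum over `Λ.filter (· ∉ T ∧ H.Adj w ·)`
  have h3 : (4 : ℝ)⁻¹ * ∑ x ∈ (Finset.univ : Finset ↥Λ).filter
        (fun x : ↥Λ => (x : Site 2) ∉ T ∧ H.Adj w (x : Site 2)), h x =
      4⁻¹ * ∑ z ∈ Λ.filter (fun z => z ∉ T ∧ H.Adj w z),
        (if hz : z ∈ Λ then h ⟨z, hz⟩ else 0) := by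
    rw [sum_filter_univ_eq_sum_filter_dite Λ (fun z => z ∉ T ∧ H.Adj w z) h]
  rw [h1, h2, h3, sum_filter_eq_sum_filter_add_sum_filter_not_mem hTΛ (fun z => H.Adj w z)]
  ring

/-- **Inverting `1 − P`.** On a finite piece of `ℤ²` (`H ≤ ℤ²`), `(1 − ¼·adjMat H Λ) g = b` forces
`g = (1 − ¼·adjMat H Λ)⁻¹ b` (`KilledGreen.isUnit_one_sub_transition`). [folklore] -/
theorem eq_inv_mulVec_of_one_sub_transition_mulVec_eq {H : SimpleGraph (Site 2)}
    (hH : H ≤ zdGraph 2) (Λ : Finset (Site 2)) {g b : ↥Λ → ℝ}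
    (hgb : ((1 : Matrix Λ Λ ℝ) - (4 : ℝ)⁻¹ • adjMat H Λ) *ᵥ g = b) :
    g = ((1 : Matrix Λ Λ ℝ) - (4 : ℝ)⁻¹ • adjMat H Λ)⁻¹ *ᵥ b := by
  rw [← hgb, Matrix.mulVec_mulVec, Matrix.nonsing_inv_mul _
    ((Matrix.isUnit_iff_isUnit_det _).1 (isUnit_one_sub_transition Λ hH)), Matrix.one_mulVec]

/-! ## Registered brick B-exit -/

/-- **Registered brick B-exit: the exit (Dirichlet / Poisson) representation.** For every subgraph
`H ≤ ℤ²`, volumes `T ⊆ Λ` and `h : Λ → ℝ` that is `P_{H|Λ}`-harmonic (`P = ¼·adjMat H Λ`) at every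
vertex of `Λ` lying in `T`, and every `u ∈ T`,
`h(u) = Σ_{w ∈ T} G_T(u, w) · ¼ Σ_{x ∈ Λ ∖ T, x ∼_H w} h(x)`,
where `G_T = greenEntry H T` is the Green's function of the walk on `ℤ²` killed at its first step that
is not an `H`-edge between `T`-sites. (The identity `H(u) = Σ_x Z_Θ(u,x) H(x)` that opens the proof of
the boundary Harnack contraction, Chelkak–Wan 2021, Lemma 3.7, for the tree's edge-killed walk; pure
finite-dimensional linear algebra: `(1 − P_T) h|_T = b`, inverted by
`KilledGreen.isUnit_one_sub_transition`.) [folklore] -/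
theorem transitionHarmonic_eq_sum_greenEntry_mul :
    ∀ (H : SimpleGraph (Site 2)), H ≤ zdGraph 2 → ∀ (Λ T : Finset (Site 2)), T ⊆ Λ → ∀ (h : ↥Λ → ℝ), (∀ x : ↥Λ, (x : Site 2) ∈ T → Matrix.mulVec ((4 : ℝ)⁻¹ • adjMat H Λ) h x = h x) → ∀ u : ↥Λ, (u : Site 2) ∈ T → h u = ∑ w ∈ T, greenEntry H T u w * ((4 : ℝ)⁻¹ * ∑ x ∈ (Finset.univ : Finset ↥Λ).filter (fun x : ↥Λ => (x : Site 2) ∉ T ∧ H.Adj w (x : Site 2)), h x) := by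
  intro H hH Λ T hTΛ h hharm u hu
  -- `h|_T = (1 − P_T)⁻¹ b`, read at the entry `u`
  have key : h u = ∑ w : ↥T, ((1 : Matrix T T ℝ) - (4 : ℝ)⁻¹ • adjMat H T)⁻¹ ⟨u, hu⟩ w *
      ((4 : ℝ)⁻¹ * ∑ x ∈ (Finset.univ : Finset ↥Λ).filter
        (fun x : ↥Λ => (x : Site 2) ∉ T ∧ H.Adj w (x : Site 2)), h x) :=
    congr_fun (eq_inv_mulVec_of_one_sub_transition_mulVec_eq hH T
      (one_sub_transition_mulVec_restrict_eq H hTΛ h hharm)) ⟨u, hu⟩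
  rw [← Finset.sum_attach T]
  exact key.trans (Finset.sum_congr rfl fun w _ => by rw [greenEntry, dif_pos ⟨hu, w.2⟩])

end Summit.CriticalPhenomena.SAWScalingLimit.Theorems.AvoidanceLimit.Anchor

end
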